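import Mathlib
import HarnessLib
import HarnessLib.Audit
import Summits.QuantumAdvantage.Statement
import Literature.Computability.Complexity.ParityQuantifier
import Literature.Computability.Complexity.Oracle
import Literature.Computability.Complexity.MultilinearExtension
import Literature.Computability.Complexity.BooleanFourier
import Literature.Computability.QuantumComplexity.RazTalForrelation
import Literature.Computability.Cryptography.ClassBQP
import Literature.Computability.Complexity.ParityClosure
import HarnessLib.Audit.Status.Attr

/-!
Route: ParityFrontier

DORMANT since 2026-08-26T12:42:52Z (reconciler: no traction for 7.1 d (last activity item-proof-filed at 2026-08-19T10:05:30Z); parked, not closed — `ledger route dormant route-QuantumAdvantage-ParityFrontier --off` to reactivate) — unstaffed, not closed; items shared with open routes are served there. `ledger route dormant <id> --off` reactivates.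

# Route QuantumAdvantage/ParityFrontier — cancellation breaks Toda's digit transfer: BQP ⊄ BP·⊕P,
with the relativized frontier reduced to level-two Fourier growth of low-degree F₂-polynomials (idea
card `parity-frontier-toda-digits`)

## Thesis X (it suffices to show X)
Words: bounded-error quantum polynomial time is not contained in BP·⊕P (Schöning's BP operator over
⊕P). Reading counting classes as digit access to one #P/GapP integer: ⊕P reads the bottom digit,
approximate counting (AM, BPP^NP) the top digits of a #P SUM, BQP the top digits of a GapP
DIFFERENCE (Fortnow–Rogers); Toda's theorem PH ⊆ BP·⊕P transfers the top digits of a sum to the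
bottom digit with randomness; X says the transfer fails for differences.
Lean: `¬ (Literature.Computability.Cryptography.BQP ⊆ Literature.Computability.Complexity.bp
Literature.Computability.Complexity.ParityP)` (decl `Target`).

## Assembly (X → Statement)
`Target → QuantumAdvantage`: BPP = bp P ⊆ bp ⊕P (`bp_mono`, `ParityClosure.P_subset_ParityP`, both
proved in the tree), so a BQP language outside BP·⊕P is outside BPP (classical one-liner, checked in
the planner's sketch). X is a strict strengthening of S: by Toda part 1 (`PH_subset_bp_ParityP`,
proved) X ⟹ BQP ⊄ PH (support `TargetGivesBQPnotPH`) — X sits one rung above Aaronson's BQP-vs-PH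
conjecture and above the summit.

## Two-layer plan (D-0019)
Layer 1 (filed now). X is hypothesis-type; the EARNED content is the relativized frontier and its
analytic core:
(rank 2) `LevelTwoGrowth` — weak CHLT level-two bound: L_{1,2}((−1)^p) ≤ 2^{n/4} for every
F₂-polynomial p of total degree ≤ n^c on 2·2^n variables, n ≥ n₀(c) [open; CHLT19 Conj. 3 predicts
O(d²)];
(rank 3) `RelFrontier` — ∃A, BQP^A ⊄ BP·⊕P^A [open; strengthens Raz–Tal's BQP^A ⊄ PH^A because Toda
relativizes];
(rank 4) `RelFrontierOfGrowth` — (2) → (3) [provable: Raz–Tal's Forrelation oracle re-run against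
bp·⊕P^A machines; a ⊕P^A predicate at a fixed input is the parity of `OracleAlg.countPoly` over ZMod
2, an F₂-polynomial of degree ≤ poly(n) in the window bits (the ⊕-analogue of
`FSS84_phWindowCircuits`); BP· is a [0,1]-average of such indicators; fooling by the level-two-only
walk `LevelTwoFooling`];
(rank 5) `FoolsLowDegree` — unconditionally the Raz–Tal distribution 𝒟 fools every F₂-polynomial of
degree ≤ (log₂N)/16 with advantage ≤ 2^{-(log₂N)/10} [provable from CHHL's proved all-level bound
(`CHHLLevelK`) and the tree's walk].
Supports: `LevelTwoFooling` (level-two-only Raz–Tal/Wu walk), `CHHLLevelK` (CHHL Thm 6.1),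
`LevelTwoQuadratic` (CHLT Conj. 3 verbatim, implies LevelTwoGrowth), `TargetGivesBQPnotPH`.
Layer 2 (only after a crux closes): split (4) into window-polynomial lemma / walk / diagonalization;
children of (2) for structured classes (symmetric, read-few polynomials — BlasiokEtAl2021) each
giving an oracle separation of BQP from the corresponding parity sub-class; the unrelativized side
of X (is AWPP ⊆ BP·⊕P? a "Toda theorem for gaps") is deliberately NOT decomposed.

Rationale: Why this line. Every relativized separation of BQP to date (vs PH: RazTalJACM2022, proved in the
tree as `exists_oracle_BQPRel_not_subset_PHRel_holds`; vs the biased counting hierarchy with GC⁰(k)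
gates: arXiv:2408.16406 Cor. 5.11) stops exactly at gates that PARITY exponentially many oracle
bits. BP·⊕P is the smallest natural class containing both BPP and PH (Toda1991;
`PH_subset_bp_ParityP` proved) whose relativized version is NOT yet separated from BQP, and
relativized bp·⊕P^A machines are precisely bounded-error averages of F₂-POLYNOMIALS OF DEGREE
poly(n) in the oracle window (FennerFortnowKurtzLi2003IC Lemma 6.12 = tree `OracleAlg.countPoly`
over ZMod 2). So Raz–Tal's framework (only the SECOND Fourier level of the distinguisher class
matters: RazTalJACM2022 §2.3, Wu2022 Thm 2) turns "oracle BQP ⊄ BP·⊕P" into the level-two Fourier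
growth of low-degree F₂-polynomials — the conjecture ChattopadhyayHatamiLovettTal2019 isolated for
PRGs for AC⁰[⊕] (Conj. 3: O(d²); known: 4·2^{6d}, ChattopadhyayEtAl2019 Thm 6.1; level one ≤ 4d,
CHLT Thm 5; structured classes BlasiokEtAl2021). Imported area: analysis of Boolean functions /
additive combinatorics (biased low-degree polynomials), on top of the tree's complete Raz–Tal chain
(Gaussian walk `abs_integral_truncEval_sub_le`, `razTalDistribution`, diagonalization vs BPP^A and
PH^A machines). Catalogue used: Fourier/spectral side (thought-starter 13) + amplification of a
proved separation one class up.
Ranked cruxes. (2) LevelTwoGrowth — the live mathematics, weakest form that suffices (2^{n/4} at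
degree n^c; CHLT predict poly(d)). (3) RelFrontier — the relativized frontier itself, closable via
(2)+(4) or by any other probabilistic-degree lower bound for the 𝒟-vs-uniform task (a Smolensky-type
dimension argument is untried). (4) RelFrontierOfGrowth — the reduction; new in print but a one-step
instance of Raz–Tal + FFKL. (5) FoolsLowDegree — unconditional base rung (degree ≤ n/16), exercises
the F₂-degree/restriction plumbing that (4) needs.
Kill criteria. A degree-polylog(N) family with L_{1,2} ≥ N^{1/4} refutes (2) and closes the Fourier
road (not (3)); a relativizing simulation BQP^A ⊆ BP·⊕P^A for all A refutes (3) and the route closes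
refuted; an unrelativized proof of AWPP ⊆ BP·⊕P (or PP ⊆ BP·⊕P) refutes Target (route closes; S
untouched; that proof would itself be a major theorem). Target proved false relative to a RANDOM
oracle is NOT a kill.
Deliberately NOT decomposed. The unrelativized Target (needs non-relativizing, non-algebrizing
technique; no claim); the digit-dictionary lemmas of the card (Lucas digit extraction in ⊕P,
Stockmeyer, FR98 form) — motivation, not load-bearing; structured special cases of (2); kit numerics
of exact L_{1,2} for small (n,d) against the d² prediction (refuter/idle work, evidence to attach to
(2)/LevelTwoQuadratic).
NOVELTY and BARRIERS: see the dedicated sections (passed with this open).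

Novelty: Searched (this session + the card's audit): `lit read` of ChattopadhyayHatamiLovettTal2019 pp.2–4
(Conj. 3, Thm 5, Claim 4), ChattopadhyayEtAl2019 §1.6/§6 (Thm 6.1: W_k ≤ (k·2^{3d})^k),
RazTalJACM2022 §1–2.3, Viola2021Fourier pp.2–4 (Thm 1), Wu2022 Thm 2; `lit galaxy search "oracle
relative to which BQP is not contained in parity P" --star all` (0 hits), `lit galaxy search
"Fourier growth" --star pdf` (9 hits: Grewal–Kumar ECCC 2024/130, Hoza 2025 notes — no BQP-vs-⊕P
oracle); remote S2/OpenAlex/arXiv rate-limited (429); tree: no ⊕P oracle separation, no F₂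
Fourier-growth fact. Nearest prior art: (i) RazTalJACM2022 Cor 1.5 + FSS84 (BQP^A ⊄ PH^A;
tree-proved); (ii) ChattopadhyayHatamiLovettTal2019 Conj. 3, motivated only by PRGs for AC⁰[⊕];
(iii) deGraafValiant2002 Cor. 6: ∃A EQP^A ⊄ MOD_{p^k}P^A (deterministic parity, Lucas digits — the
BP· operator is exactly what is open); (iv) arXiv:2408.16406 Cor 5.11 (BQP vs biased CH with GC⁰(k)
gates: the current frontier below parity-everywhere); (v) arXiv:2111.10409 (no ⊕P claim). Delta: the
target BQP ⊄ BP·⊕P as the summit-strengthening one rung above BQP ⊄ PH; the typed reduction "weak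
CHLT level-two growth ⟹ ∃A BQP^A ⊄ BP·⊕P^A" via countPoly mod 2 (unprinted, immediate for experts);
the unconditional rung (𝒟 fools degree ≤ log N/16). Card graded new-combination by the novelty
audit; this route claims no more.  [refs: 2408.16406, 2111.10409, ChattopadhyayHatamiLovettTal2019, ChattopadhyayEtAl2019, RazTalJACM2022, Wu2022]

Barriers (technique_class: fourier-growth): - Literature.Barriers.QuantumAdvantage.SeparationPrerequisites: applies to Target a fortiori (Target
⟹ S and ⟹ BQP ⊄ PH); not evaded — Target is hypothesis-type; earned items are relativized/analytic.
- Literature.Barriers.QuantumAdvantage.Relativization,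
Literature.Barriers.QuantumAdvantage.Algebrization: embraced — cruxes 3–5 are oracle statements
(lineage of tree S13/S14); Ko's collapsing oracle gives BQP^A ⊆ BP·⊕P^A, so Target needs
non-relativizing, non-algebrizing (AW08) technique; none claimed.
- Literature.Barriers.QuantumAdvantage.TotalFunctionSpeedupLimit: respected — distributional
Forrelation, not a total function.
- Literature.Barriers.QuantumAdvantage.RandomOracleMethod,
Literature.Barriers.QuantumAdvantage.NaturalProofs,
Literature.Barriers.QuantumAdvantage.PPolyOracles,
Literature.Barriers.QuantumAdvantage.SupremacyTheoremsNonRelativizing: n/a (designed distribution;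
no circuit bound, P/poly-oracle, PH-collapse or sampling claim).
- UNCATALOGUED, load-bearing: Viola2021Fourier Thm 1 — M₂(p) ≤ o(√N) for all F₂-polynomials of
degree ≥ log₂N yields NEW correlation bounds (h₂ = sign Σ x_i x_j beats the Razborov–Smolensky
tradeoff 1/2−Ω(d/√N), Smolensky1987). LevelTwoGrowth implies such a bound: crux 2 sits AT the
correlation-bounds barrier (PneNP side: Shaltiel–Viola). Not evaded; the bet is that level-two
growth (level one, d = O(1), symmetric/read-few cases proved) is its tractable face. RelFrontier
needs only 1/polylog advantage for ONE task and is not known to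

History (route lifecycle, newest last):
- 2026-08-16T02:17:39Z · AUTO-CRUX: 1 conjecture-grade item(s) promoted to crux (LevelTwoQuadratic) — refuter vetting / tiering apply (operator:999:1362873)
- 2026-08-16T04:15:06Z · AUTO-CRUX (backfill): Target — hypotheses of the deciding theorem that nothing in the route derives are cruxes (operator:999:1085951)
- 2026-08-26T12:42:52Z · DORMANT — reconciler: no traction for 7.1 d (last activity item-proof-filed at 2026-08-19T10:05:30Z); parked, not closed — `ledger route dormant route-QuantumAdvantage-Pa (operator:999:2728684)

sub-problem: QuantumAdvantage · status: dormant · opened planner-plancard-QuantumAdvantage-QuantumAdva-1586f8db-0 2026-08-15T10:59:55Z · rev 2 · ledger route-QuantumAdvantage-ParityFrontier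
GENERATED by the gate from the ledger (D-0016/17). Provers cite these decls: `theorem foo : Summit.QuantumAdvantage.QuantumAdvantage.Theses.ParityFrontier.<Decl> := …` in Summits/QuantumAdvantage/QuantumAdvantage/Theorems/<Name>.lean.
-/

namespace Summit.QuantumAdvantage.QuantumAdvantage.Theses.ParityFrontier

open scoped BigOperators Topology Manifold Classical MeasureTheory ProbabilityTheory Matrix InnerProductSpace ComplexConjugate ContinuousMap
open Filter Set Function TopologicalSpace MeasureTheory

attribute [summit_statement] _root_.QuantumAdvantage

open Literature.QuantumAdvantage

/-- item stmt-QuantumAdvantage-1952 · crux (kind.auto-crux: conjecture-grade) · rank 0 · open · by planner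
why it might fail: Refuted outright by any proof of BQP ⊆ BP·⊕P — a 'Toda theorem for GapP gaps' (AWPP ⊆ BP·⊕P or PP ⊆ BP·⊕P, both open); and unprovable by relativizing/algebrizing technique: collapsing oracles give BQP^A ⊆ BPP^A ⊆ BP·⊕P^A (tree: exists_oracle_BQPRel_subset_BPPRel_holds).
sources: Toda1991, FortnowRogers1999JCSS, Aaronson2010, Ko1989
[target] X_D: BQP ⊄ BP·⊕P — 'Toda's digit transfer (PH ⊆ BP·⊕P: top digits of a #P sum reduce to the
bottom digit) fails for the top digits of a GapP difference, which is what BQP reads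
(FortnowRogers1999JCSS)'. Hypothesis-type: implies the summit (Assembly) and BQP ⊄ PH
(TargetGivesBQPnotPH, via the proved `PH_subset_bp_ParityP`). Refuting it = proving BQP ⊆ bp ParityP
('Toda for gaps'; AWPP ⊆ BP·⊕P and PP ⊆ BP·⊕P are open and would each do it). Sources: Toda1991;
AroraBarak2009 §17.4; Aaronson2010 §1 (BQP vs PH). -/
@[route_item "route-QuantumAdvantage-ParityFrontier", crux]
def Target : Prop :=
  ¬ (Literature.Computability.Cryptography.BQP ⊆ Literature.Computability.Complexity.bp Literature.Computability.Complexity.ParityP)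

/-- item stmt-QuantumAdvantage-1953 · crux · rank 2 · open · by planner
why it might fail: May be false: an explicit degree-polylog(N) F₂-family (addressing/pseudorandom type) could carry level-two mass ≥ N^{1/4} — proved: only L_{1,2} ≤ 4·2^{6d} (CHHL Thm 6.1), degree 2 (2412.10842), structured classes; any proof breaks the log n-degree correlation barrier for h₂ (Viola2021 Thm 1).
sources: ChattopadhyayHatamiLovettTal2019, ChattopadhyayEtAl2019, BlasiokEtAl2021, Viola2021Fourier, 2412.10842, 2501.02653
[crux] Weak CHLT level-two Fourier growth: for every c there is n₀ such that for n ≥ n₀ every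
F₂-polynomial p of total degree ≤ n^c on 2·2^n variables has Σ_{|S|=2} |f̂(S)| ≤ 2^{n/4} for f =
(−1)^p (tree: `fourierL1Level f 2`, f read through `sgn`; the Boolean function is `decide (eval
(boolPt x) p = 1)`). ChattopadhyayHatamiLovettTal2019 Conj. 3 predicts O(d²) = O(n^{2c}) (filed
verbatim as support LevelTwoQuadratic, which implies this); known: 4·2^{6d} (ChattopadhyayEtAl2019
Thm 6.1), level one ≤ 4d (CHLT Thm 5), symmetric / read-few / small-composition classes
(BlasiokEtAl2021). This 2^{n/4}-at-degree-n^c form is exactly what RelFrontierOfGrowth consumes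
(restrictions are automatic: they do not raise total degree). OPEN both ways; BARRIER: by
Viola2021Fourier Thm 1 it implies a correlation bound for h₂ beyond Razborov–Smolensky (see route
Barriers). Negative side welcome: a degree-polylog(N) family with level-two mass ≥ N^{1/4} refutes
it (kit: exact L_{1,2} of random/structured degree-d polynomials for small n). -/
@[route_item "route-QuantumAdvantage-ParityFrontier"]
def LevelTwoGrowth : Prop :=
  ∀ c : ℕ, ∃ n₀ : ℕ, ∀ n ≥ n₀, ∀ p : MvPolynomial (Fin (2 * 2 ^ n)) (ZMod 2), p.totalDegree ≤ n ^ c → Literature.Computability.QuantumComplexity.fourierL1Level (fun x : Fin (2 * 2 ^ n) → Bool => decide (MvPolynomial.eval (Literature.Computability.Complexity.Multilinear.boolPt x) p = 1)) 2 ≤ (2 : ℝ) ^ (n / 4)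

/-- item stmt-QuantumAdvantage-1954 · crux · rank 3 · open · by planner
why it might fail: False iff every polylog-query quantum task has polylog probabilistic F₂-degree (a relativizing 'Toda for GapP gaps': AWPP^A ⊆ BP·⊕P^A) — not excluded: 𝒟_RT is only known to fool F₂-degree ≤ c·log N (CHHL k=2 + GK24 Lem 5.3); fooling degree ≥ log N / AC⁰[⊕] is long-standing open (CHLT19 §1.1).
sources: RazTalJACM2022, ChattopadhyayHatamiLovettTal2019, ChattopadhyayEtAl2019, 2408.16406, 2501.02653, Toda1991
[crux] The relativized parity frontier: some oracle A has BQP^A ⊄ BP·⊕P^A, typed with the tree's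
classes exactly as S13/S14 (`BQPRel A`, `bp (pParity (PRel (Oracle.ofLanguage A)))` = Schöning's BP·
over ⊕·P^A). Strengthens the proved `exists_oracle_BQPRel_not_subset_PHRel_holds` (Toda relativizes:
PH^A ⊆ BP·⊕P^A). Closable by LevelTwoGrowth + RelFrontierOfGrowth, or by ANY probabilistic-F₂-degree
lower bound for distinguishing the Raz–Tal distribution 𝒟^{⊗m} from uniform with constant advantage
(a Smolensky-dimension or rank/bias argument is untried and would dodge Viola's implication).
Sanity: deterministic ⊕P^A is trivial (Reed–Muller distance forces degree Ω(N) on the Forrelation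
promise; cf. deGraafValiant2002 Cor. 6 for EQP vs Mod_{p^k}P), and PP^A ⊄ BP·⊕P^A follows from
Razborov–Smolensky (Smolensky1987) — the BP· operator over BQP is the open case. -/
@[route_item "route-QuantumAdvantage-ParityFrontier"]
def RelFrontier : Prop :=
  ∃ A : Language Bool, ¬ (Literature.Computability.Cryptography.BQPRel A ⊆ Literature.Computability.Complexity.bp (Literature.Computability.Complexity.pParity (Literature.Computability.Complexity.PRel (Literature.Computability.Complexity.Oracle.ofLanguage A))))

/-- item stmt-QuantumAdvantage-1959 · crux (kind.auto-crux: conjecture-grade) · rank 9 · open · by planner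
why it might fail: auto-crux — conjecture-grade statement (docstring avows it ('Conjecture')); it is open, so it may simply be false
sources: ChattopadhyayHatamiLovettTal2019, Viola2021Fourier, BlasiokEtAl2021
[support] ChattopadhyayHatamiLovettTal2019 Conjecture 3 verbatim: L_{1,2}(Pol_{n,d}) = O(d²) — ∃C ∀
m d, every F₂-polynomial of total degree ≤ d on m variables has level-two Fourier mass ≤ C·d².
Implies LevelTwoGrowth (C n^{2c} ≤ 2^{n/4} eventually); strictly stronger than the route needs,
filed so that refuters' counterexample hunts and kit numerics (exact L_{1,2} for all cubics on ≤ 7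
variables, random degree-d polynomials on ≤ 20 variables vs the d² prediction) have a home; its
refutation would NOT break the route (drop). Evidence in print: CHLT Thm 5 (level one ≤ 4d),
read-once polynomials O(log n)^8, d = O(1) by CHHL; Viola2021Fourier Thms 7/9 try and fail to
disprove it via Majority. -/
@[route_item "route-QuantumAdvantage-ParityFrontier"]
def LevelTwoQuadratic : Prop :=
  ∃ C : ℝ, ∀ (m d : ℕ) (p : MvPolynomial (Fin m) (ZMod 2)), p.totalDegree ≤ d → Literature.Computability.QuantumComplexity.fourierL1Level (fun x : Fin m → Bool => decide (MvPolynomial.eval (Literature.Computability.Complexity.Multilinear.boolPt x) p = 1)) 2 ≤ C * (d : ℝ) ^ 2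

/-- item stmt-QuantumAdvantage-1955 · support · rank 4 · open · by planner
why it might fail: As typed it can fail only through the model: the level-two-only walk (LevelTwoFooling) must close with lower-order terms o(1/rtBlocks n), and `pParity (PRel O)` query-length bounds must reach the window addresses (rtLen n ≈ n + O(log n): fine). Else restate with all-level hypotheses.
sources: RazTalJACM2022, Wu2022, 2408.16406, FennerFortnowKurtzLi2003IC, Ko1989
[crux] The reduction LevelTwoGrowth → RelFrontier (sibling decls). Proof plan (all ingredients in
the tree except the level-two-only walk, filed as support LevelTwoFooling): (a) window-polynomial
lemma — for L' ∈ pParity (PRel O) and fixed input z, the predicate 'Odd #{y : ⟨z,y⟩ ∈ L''}' as a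
function of an injectively addressed oracle window is `MvPolynomial.eval (boolPt w)
(OracleAlg.countPoly M v k inp) = (1 : ZMod 2)` with totalDegree ≤ fuel k = poly(|z|)
(`eval_countPoly`, `totalDegree_countPoly_le`, FennerFortnowKurtzLi2003IC Lemma 6.12) — the
⊕-analogue of `FSS84_phWindowCircuits`; (b) a bp-machine's acceptance probability g(w) =
E_r[indicator] is [0,1]-valued with level-two mass of every restriction ≤ ½·max_r L_{1,2} ≤ 2^{n/4}
by LevelTwoGrowth (c ≥ machine exponent); (c) LevelTwoFooling gives |E_𝒟 g − E_U g| ≤ C ε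
2^{n/4}/2^{n/2} + C/2^n per block, hybrid over m = `rtBlocks n` blocks (restrictions of degree-≤d
polynomials are degree ≤ d), then the stage diagonalization of
`OracleSeparationBQPBPP.exists_oracle_BQPRel_not_subset_BPPRel_of` verbatim with
`razTal2022_bqpMachine_holds`, `razTal2022_claim81_holds`, `countable_polyTimeOracleAlg_holds`.
Sources: RazTalJACM2022 App. -/
@[route_item "route-QuantumAdvantage-ParityFrontier"]
def RelFrontierOfGrowth : Prop :=
  LevelTwoGrowth → RelFrontier

/-- item stmt-QuantumAdvantage-1956 · support · rank 5 · open · by planner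
why it might fail: Constants: CHHL's bound is (k·2^{3d})^k, not L^k, so the tree's walk theorem does not apply verbatim; if the two-regime/small-step repair loses more than 2^{n/40} the thresholds n/16, n/10 must be relaxed (restate, same content).
sources: ChattopadhyayEtAl2019, RazTalJACM2022, Wu2022, 2408.16406
[crux] Unconditional base rung: for n ≥ n₀ the Raz–Tal distribution 𝒟 = `razTalDistribution n` on 2N
= 2·2^n bits fools every F₂-polynomial of total degree ≤ n/16: |Pr_𝒟[p = 1] − Pr_U[p = 1]| ≤
2^{-⌊n/10⌋}. Proof plan: CHHL all-level bound W_k((−1)^p) ≤ (k·2^{3d})^k (support CHHLLevelK) for p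
and all its restrictions, fed to the tree's walk `abs_integral_truncEval_sub_le` GENERALISED to a
two-regime level hypothesis (the k^k factor breaks the pure L^k form: use CHHL for k ≤ k₀ ≈ 6n/log n
and Cauchy–Schwarz/Parseval + `abs_gaussMoment_le` for k > k₀), or to LevelTwoFooling; numerics:
12ε·4·64^d/√N ≤ (3/n)·2^{3n/8−n/2} = (3/n)2^{−n/8} ≪ 2^{−n/10}, lower-order 16/N. Consequence (not
filed): oracle separations of BQP from parity machines of LINEAR degree; the rung exercises the
F₂-degree/restriction plumbing (MvPolynomial.totalDegree under partial evaluation) that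
RelFrontierOfGrowth needs. -/
@[route_item "route-QuantumAdvantage-ParityFrontier"]
def FoolsLowDegree : Prop :=
  ∃ n₀ : ℕ, ∀ n ≥ n₀, ∀ p : MvPolynomial (Fin (2 * 2 ^ n)) (ZMod 2), p.totalDegree ≤ n / 16 → |∑ w, (Literature.Computability.QuantumComplexity.razTalDistribution n w).toReal * (if MvPolynomial.eval (Literature.Computability.Complexity.Multilinear.boolPt w) p = 1 then (1 : ℝ) else 0) - (∑ w : Fin (2 * 2 ^ n) → Bool, if MvPolynomial.eval (Literature.Computability.Complexity.Multilinear.boolPt w) p = 1 then (1 : ℝ) else 0) / 2 ^ (2 * 2 ^ n)| ≤ (1 / 2 : ℝ) ^ (n / 10)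

/-- item stmt-QuantumAdvantage-1957 · support · rank 9 · open · by planner
sources: RazTalJACM2022, Wu2022, ChattopadhyayHatamiLovettTal2019
[support] Level-two-only Raz–Tal walk (RazTalJACM2022 §2.3 'all terms except k = 2 can essentially
be ignored'; Wu2022 Thm 2, stopped Brownian form |E f(X_τ) − E f(U)| ≤ 2εγt): for real g bounded by
1 whose every restriction has level-two Fourier mass ≤ t (`cubeFourierCoeff`, `J.piecewise σ`), |E_𝒟
g − E_U g| ≤ C·ε·t/√N + C/N, ε = `razTalEps (2^n)`. Proof: the tree's §7 machinery
(`razTal_claim72/73`, `sum_razTalDistribution_mul`, Gaussian walk `razTalGaussian_prod_map_add`)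
with SMALL steps p ≤ N^{-2} so that levels ≥ 4 die by Parseval + moment bounds; the exit event must
be handled by freezing the walk at first exit of [−1/2,1/2]^{2N} plus an exponential-moment maximal
inequality (Doob) per coordinate — NOT the t = N union bound of the printed proof. Shared lemma of
RelFrontierOfGrowth and (optionally) FoolsLowDegree. If C/N is too optimistic for the lower-order
terms, restate with C·t/N — harmless downstream. -/
@[route_item "route-QuantumAdvantage-ParityFrontier"]
def LevelTwoFooling : Prop :=
  ∃ C : ℝ, ∃ n₀ : ℕ, ∀ n ≥ n₀, ∀ g : (Fin (2 * 2 ^ n) → Bool) → ℝ, (∀ w, |g w| ≤ 1) → ∀ t : ℝ, 1 ≤ t → (∀ (J : Finset (Fin (2 * 2 ^ n))) (σ : Fin (2 * 2 ^ n) → Bool), ∑ S ∈ (Finset.univ : Finset (Fin (2 * 2 ^ n))).powersetCard 2, |Literature.Computability.Complexity.LowDegree.cubeFourierCoeff (fun x => g (J.piecewise σ x)) S| ≤ t) → |∑ w, (Literature.Computability.QuantumComplexity.razTalDistribution n w).toReal * g w - (∑ w, g w) / 2 ^ (2 * 2 ^ n)| ≤ C * Literature.Computability.QuantumComplexity.razTalEps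 (2 ^ n) * t / Real.sqrt (2 ^ n) + C / 2 ^ n

/-- item stmt-QuantumAdvantage-1958 · support · rank 9 · open · by planner
sources: ChattopadhyayEtAl2019, 10.4230/LIPIcs.CCC.2018.1
[support] ChattopadhyayEtAl2019 (ToC 15(10); CCC 2018) Thm 6.1: for an F₂-polynomial p of degree ≤ d
and f = (−1)^p, Σ_{|S|=k} |f̂(S)| ≤ (k·2^{3d})^k for every k ≥ 1 (form read off the printed proof:
'assume towards a contradiction that W(d,k) > (k2^{3d})^k'; CHLT quote the case k = 2 as 4·2^{6d}).
Proof ≈ 2 pages: Lemma 6.2 (a recursion for W(d,k) via the multiplicative derivative h_{y,z}, degree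
d−1, and Claims 6.3–6.5), induction on d then k. Needed by FoolsLowDegree. If the printed constant
differs, restate (support item). -/
@[route_item "route-QuantumAdvantage-ParityFrontier"]
def CHHLLevelK : Prop :=
  ∀ (m d k : ℕ) (p : MvPolynomial (Fin m) (ZMod 2)), p.totalDegree ≤ d → 1 ≤ k → Literature.Computability.QuantumComplexity.fourierL1Level (fun x : Fin m → Bool => decide (MvPolynomial.eval (Literature.Computability.Complexity.Multilinear.boolPt x) p = 1)) k ≤ ((k : ℝ) * 2 ^ (3 * d)) ^ k

/-- item stmt-QuantumAdvantage-1960 · support · rank 9 · open · by planner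
sources: Toda1991, Aaronson2010
[support] Corollary recording the logical position of X_D: Target → BQP ⊄ PH, one line from the
PROVED Toda part 1 `Literature.Computability.Complexity.PH_subset_bp_ParityP` (TodaPartOne.lean):
BQP ⊆ PH ⊆ bp ParityP would contradict Target. (Checked in the planner's sketch.) Sources: Toda1991
§3; Aaronson2010 §1. -/
@[route_item "route-QuantumAdvantage-ParityFrontier"]
def TargetGivesBQPnotPH : Prop :=
  Target → ¬ (Literature.Computability.Cryptography.BQP ⊆ Literature.Computability.Complexity.PH)

/-- item stmt-QuantumAdvantage-1961 · assembly · rank 1 · closed · proved by Summit.QuantumAdvantage.QuantumAdvantage.Theorems.ParityFrontier.Assembly_proof @ 27fc3325a297 (prover) · by planner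
sources: AroraBarak2009, Schoning1989
[assembly] Target → QuantumAdvantage: the summit is ∃ L ∈ BQP, L ∉ BPP; if it failed, BQP ⊆ BPP = bp
P ⊆ bp ParityP (`Literature.Computability.Complexity.bp_mono`, `ParityClosure.P_subset_ParityP`),
contradicting Target. Classical one-liner (by_contra), checked in the planner's sketch. -/
@[route_item "route-QuantumAdvantage-ParityFrontier"]
def Assembly : Prop :=
  Target → QuantumAdvantage

-- `Assembly` holds: proved by `Summit.QuantumAdvantage.QuantumAdvantage.Theorems.ParityFrontier.Assembly_proof` @ 27fc3325a297 (its module imports this route file, so no `_holds` link can be stated here).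

/-! D-0027 §2.1 — DECIDING THEOREM (planner-authored via `route open/edit --closes-file`; by planner-rbadge-QuantumAdvantage-ParityFrontier-22a4ee0e-g2-0 2026-08-15T16:20:25Z):
its hypotheses are this route's items and its conclusion the sub-problem Statement (glue_lint), and it elaborates with this file. -/

@[closes "route-QuantumAdvantage-ParityFrontier"] theorem closes (h0 : Target) : _root_.QuantumAdvantage := by
  by_contra hS
  apply h0
  intro L hL
  have hBPP : L ∈ Literature.Computability.Complexity.BPP := by
    by_contra hnot
    exact hS ⟨L, hL, hnot⟩
  exact Literature.Computability.Complexity.bp_mono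
    Literature.Computability.Complexity.ParityClosure.P_subset_ParityP hBPP

end Summit.QuantumAdvantage.QuantumAdvantage.Theses.ParityFrontier
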